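import Summits.CriticalPhenomena.PercolationContinuityZ3.Theorems.PercNearOneGluingNoHeavyQuantFarK5Cert
import Summits.CriticalPhenomena.PercolationContinuityZ3.Theorems.PercNearOneGluingNoHeavyLowerTailCILSeriesReduction
import Summits.CriticalPhenomena.PercolationContinuityZ3.Theorems.PercNearOneGluingNoHeavyLowerTailCILPendantPeeling
import HarnessLib

/-!
# QUANT lane R8, FAR beyond trees: the FAR instance is invariant under SUPPORT REDUCTIONS — pruning a pendant non-relay vertex and
# series-reducing a degree-two non-relay vertex

builds on p205010 (kernel theorem, internal audit signed; external expert review pending)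

Support file (`--supports stmt-CriticalPhenomena-4575`), QUANT lane seat prim-quant-p1 (gen 14); memo
`run/shared/lean/prim/quant/prim-quant-p1-g14/FOR-LEAD-UNICYCLIC.md` §4 (III).  Theorems only; no definitions, no sorries, standard axioms.

`TwoCopy.FARp w A o j` (`…QuantFarK5Cert`) is the instance of `Quant.FarRelayRow` at `(w, A, o, j)`: `2j < Σ_{a∈A} P(o ↔ a)` and `P(o ↮ a) ≤ t` on `A`
imply `P(#{a ∈ A | o ↔ a} ≤ j) ≤ t`.  It is a statement about the LAW OF THE RELAY SET `π(o) = {a ∈ A | o ↔ a}` only (the marginals are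
`P(a ∈ π(o))`, the event is `|π(o)| ≤ j`).  Two classical operations on a weighted graph leave that law unchanged when performed at a vertex that is
neither the observer nor a relay, and both are already in the kernel as law identities of the hull-port / pendant-peeling lines:

* `TwoCopy.farp_iff_of_pendant` — **pendant pruning**: if the only positive-weight pair at `v ∉ A`, `v ≠ o` is `s(v, g)`, then
  `FARp w A o j ↔ FARp (w[s(v,g) ↦ 0]) A o j` (`PendantPeeling.lightness_eq_of_pendant`, applied to `A` and to the singletons `{a}` at layer `0`).
* `TwoCopy.farp_iff_of_series` — **series reduction**: if `z ∉ A`, `z ≠ o` has positive-weight pairs only to `x ≠ y`, and `w'` is the series-reduced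
  weight function (pairs at `z` switched off, `w' s(x,y) = 1 − (1 − w s(x,y))(1 − w s(z,x)·w s(z,y))`, all other pairs unchanged), then
  `FARp w A o j ↔ FARp w' A o j` (`HullPort.series_reduction` with the predicates `|·| ≤ j` and `a ∉ ·`).
Use (memo §4 (III)): after pruning and series reduction every non-terminal vertex of the support has degree `≥ 3`, so FAR with `|A| = 3` on ALL
unicyclic supports reduces to the unicyclic supports on `≤ 8` vertices — a finite certificate census (prim-cert-1's `TwoCopy.FARp.of_check_on`).
[folklore — series law / pendant edges of network reliability]; product measure [cite: Grimmett1999, §1.3 p. 10; §2.4].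
-/

noncomputable section

namespace Summit.CriticalPhenomena.PercolationContinuityZ3.Theorems.TwoCopy

open MeasureTheory Set Finset
open Literature.Probability.LatticeModels
open Literature.Probability.Percolation
open scoped Classical

variable {n : ℕ}

/-- The complement of `{o ↔ a}` is the layer-`0` light event of the one-relay set `{a}`. [folklore] -/
theorem compl_openConn_eq_filter_singleton (o a : Fin n) :
    (openConn o a : Set (BondConfig (Fin n)))ᶜ =
      {ω : BondConfig (Fin n) | (({a} : Finset (Fin n)).filter fun r => ω ∈ openConn o r).card ≤ 0} := by
  ext ω
  simp only [Set.mem_compl_iff, Set.mem_setOf_eq, Nat.le_zero, Finset.card_eq_zero, Finset.filter_eq_empty_iff,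
    Finset.mem_singleton, forall_eq]

/-- **`FARp` transfers along an equality of laws of the relay set.**  If under `w` and `w'` the events `{#{a ∈ A | o ↔ a} ≤ j}` have the same
probability and every relay has the same connection probability, then `FARp w A o j ↔ FARp w' A o j`. [this work] -/
theorem farp_iff_of_laws_eq (w w' : Sym2 (Fin n) → unitInterval) (A : Finset (Fin n)) (o : Fin n) (j : ℕ)
    (hev : (prodBernoulli w).real {ω : BondConfig (Fin n) | (A.filter fun a => ω ∈ openConn o a).card ≤ j} =
      (prodBernoulli w').real {ω : BondConfig (Fin n) | (A.filter fun a => ω ∈ openConn o a).card ≤ j})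
    (hmarg : ∀ a ∈ A, (prodBernoulli w).real (openConn o a)ᶜ = (prodBernoulli w').real (openConn o a)ᶜ) :
    FARp w A o j ↔ FARp w' A o j := by
  have hmeas : ∀ (u : Sym2 (Fin n) → unitInterval) (S : Set (BondConfig (Fin n))), MeasurableSet S :=
    fun _ S => (Set.toFinite S).measurableSet
  have hmarg' : ∀ a ∈ A, (prodBernoulli w).real (openConn o a) = (prodBernoulli w').real (openConn o a) := by
    intro a ha
    have h1 : (prodBernoulli w).real (openConn o a : Set (BondConfig (Fin n)))ᶜ =
        1 - (prodBernoulli w).real (openConn o a : Set (BondConfig (Fin n))) := probReal_compl_eq_one_sub (hmeas w _)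
    have h2 : (prodBernoulli w').real (openConn o a : Set (BondConfig (Fin n)))ᶜ =
        1 - (prodBernoulli w').real (openConn o a : Set (BondConfig (Fin n))) := probReal_compl_eq_one_sub (hmeas w' _)
    have := hmarg a ha
    linarith
  have hsum : ∑ a ∈ A, (prodBernoulli w).real (openConn o a) = ∑ a ∈ A, (prodBernoulli w').real (openConn o a) :=
    Finset.sum_congr rfl hmarg'
  constructor
  · intro h hEN t ht
    rw [← hev]
    exact h (by rw [hsum]; exact hEN) t (fun a ha => by rw [hmarg a ha]; exact ht a ha)
  · intro h hEN t ht
    rw [hev]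
    exact h (by rw [← hsum]; exact hEN) t (fun a ha => by rw [← hmarg a ha]; exact ht a ha)

/-- **Pendant pruning.**  If the only positive-weight pair at a vertex `v` that is neither the observer nor a relay is `s(v, g)` (`g ≠ v`), then the
FAR instance at `(A, o, j)` is the same for `w` and for `w` with that pair switched off. [folklore; via `PendantPeeling.lightness_eq_of_pendant`] -/
theorem farp_iff_of_pendant (w : Sym2 (Fin n) → unitInterval) (A : Finset (Fin n)) (o : Fin n) (j : ℕ) {v g : Fin n}
    (hgv : g ≠ v) (hvA : v ∉ A) (hov : o ≠ v) (hpend : ∀ u : Fin n, u ≠ v → u ≠ g → w s(v, u) = 0) :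
    FARp w A o j ↔ FARp (Function.update w s(v, g) 0) A o j := by
  refine farp_iff_of_laws_eq w _ A o j (PendantPeeling.lightness_eq_of_pendant w A j hgv hvA hov hpend) fun a ha => ?_
  have hva : v ∉ ({a} : Finset (Fin n)) := by
    rw [Finset.mem_singleton]; exact fun h => hvA (h ▸ ha)
  rw [compl_openConn_eq_filter_singleton]
  exact PendantPeeling.lightness_eq_of_pendant w {a} 0 hgv hva hov hpend

/-- **Series reduction.**  Let `z` be neither the observer nor a relay, with positive-weight pairs only to `x` and `y` (`x, y, z` distinct), and let `w'`
switch off the pairs at `z`, keep `w` on every other pair except `s(x, y)`, where `w' s(x,y) = 1 − (1 − w s(x,y))(1 − w s(z,x)·w s(z,y))`.  Then the FAR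
instance at `(A, o, j)` is the same for `w` and `w'`. [folklore — series law; via `HullPort.series_reduction`] -/
theorem farp_iff_of_series (w w' : Sym2 (Fin n) → unitInterval) (A : Finset (Fin n)) (o : Fin n) (j : ℕ) {z x y : Fin n}
    (hzA : z ∉ A) (hoz : o ≠ z) (hzx : z ≠ x) (hzy : z ≠ y) (hxy : x ≠ y)
    (hz : ∀ v, v ≠ z → v ≠ x → v ≠ y → w s(z, v) = 0)
    (hw'z : ∀ v, v ≠ z → w' s(z, v) = 0) (hw'zz : w' s(z, z) = w s(z, z))
    (hw'off : ∀ e : Sym2 (Fin n), z ∉ e → e ≠ s(x, y) → w' e = w e)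
    (hw'xy : (w' s(x, y) : ℝ) = 1 - (1 - w s(x, y)) * (1 - w s(z, x) * w s(z, y))) :
    FARp w A o j ↔ FARp w' A o j := by
  refine farp_iff_of_laws_eq w w' A o j
    (HullPort.series_reduction w w' A z x y hzA hzx hzy hxy hz hw'z hw'zz hw'off hw'xy o hoz (fun s => s.card ≤ j)) fun a ha => ?_
  have hset : (openConn o a : Set (BondConfig (Fin n)))ᶜ = {ω : BondConfig (Fin n) | a ∉ A.filter fun r => ω ∈ openConn o r} := by
    ext ω
    simp only [Set.mem_compl_iff, Set.mem_setOf_eq, Finset.mem_filter, not_and]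
    exact ⟨fun h _ => h, fun h => h ha⟩
  rw [hset]
  exact HullPort.series_reduction w w' A z x y hzA hzx hzy hxy hz hw'z hw'zz hw'off hw'xy o hoz (fun s => a ∉ s)

end Summit.CriticalPhenomena.PercolationContinuityZ3.Theorems.TwoCopy

end
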